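import Summits.Parity.GeneralizedHardyLittlewood.Theorems.BeyondDiagonalBeatsQuarter.OffDiagCoreWinMembers
import Summits.Parity.GeneralizedHardyLittlewood.Theorems.BeyondDiagonalBeatsQuarter.OffDiagCoreWinMemberBlock
import Summits.Parity.GeneralizedHardyLittlewood.Theorems.BeyondDiagonalBeatsQuarter.OffDiagCoreWinFamilyBound
import HarnessLib

/-!
# Route `PrimeLevelFamEdge`, crux K_B (stmt-Parity-20343), line `diagonal_kernel_split` rev 4, plan Ω,
# node **L7d part 2, leaf G3 — the block family of G2a at one box point, bounded by the aggregate large sieve (F2b)**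
# (L7D-PLAN rev 7 §7 G3)

At a box point `τ ∈ [1/2,2]²`, for one block `b` (levels `[N+bL, N+bL+L−1]`), one completion index `k` and one trinomial
index `w`, the member sum of G2a `coreWin_eq_sum_blocks_integral_family` is restricted to the GOOD members (`h₁ ≠ 0`, admissible,
selected — the others have zero weight) and handed to F2b `norm_sum_family_levelFactor_le` with moduli `switchMod`, classes
`switchClass`, the reciprocal block `[1/(β₂+1), 1/β₁]` and the member Taylor radii guaranteed by the selector:

* **`norm_blockFamily_le`** — `‖Σ_x c_{x,b,k,w}·Kern_x(τ)·levelLargePart R G_b (g_{k,w}Ψ_τ(x)) n_x a_x‖ ≤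
  (Σ_{j<J} 2^{−j}‖(g_{k,w}ρ_j)𝟙_{G_b}‖₂)·(Σ_{(h,c)} (Σ_{good x→(h,c)} ‖c_x Kern_x(τ)‖)²)^{1/2}·(1+log H_D)(2(N+1)/R + 4H_D)^{1/2}
   + J2^{−J}·(Σ_{good x} ‖c_x Kern_x(τ)‖)·Σ_{q∈G_b}‖g_{k,w}(q)‖`.

Pure inequality bookkeeping; standard axioms. Helper toward `stub_offDiagBelowSlack_io`; closes nothing.
«The programme SEARCHES and TYPES; no claim about Landau–Siegel zeros, Theorems 1–2 of arXiv:2211.02515 or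
a repaired Margin232 until a kernel theorem says so.»
-/

noncomputable section

open Finset Real Complex MeasureTheory Polynomial
open scoped Nat

namespace Summit.Parity.GeneralizedHardyLittlewood.Theorems.BeyondDiagonalBeatsQuarter.OffDiag

open Literature.Analysis.FunctionSpaces (besselJ)
open Literature.Analysis.Calculus.WhitneyConvex (dyadicBump)
open Literature.NumberTheory.LFunctions Literature.NumberTheory.LFunctions.KMV2000
open Literature.NumberTheory.Sieve.FriedlanderIwaniecPrimes (fourier2 ker)
open Literature.NumberTheory.Sieve.LargeSieve (e sepCoeff sepWeight)
open PeterssonSplit (nearBoxes)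

open Classical in
/-- **The block family at one box point, bounded by the aggregate large sieve.** Data: `1 ≤ N`, `1 ≤ L ≤ N`, levels `G` prime in
`(N, 2N]`, a block index `b`, threshold `1 ≤ R`, modulus cap `H_D ≤ N`, Taylor depth `J ≥ 1`, a box point `τ ∈ [1/2,2]²`, a
selector `D` such that every selected member has `|h₁| ≤ H_D` and Taylor radius admitting the reciprocal block
`[1/(β₂+1), 1/β₁]` (`β₁ = N+bL`, `β₂ = β₁+L−1`); any `Δ′, ε₀, T, k`, trinomial index `w`.
[cite: KowalskiMichelVanderKam2000, §6 p. 19 — derivation; Davenport1980, ch. 29 — derivation] -/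
theorem norm_blockFamily_le (R : ℕ) (hR : 1 ≤ R) {D : ℕ → ℕ → ℕ → ℕ → ℕ → ℕ × ℕ → ℤ → ℤ → ℂ} {N H_D : ℕ} (hN : 1 ≤ N)
    (hH : H_D ≤ N) (T : ℕ → ℕ → ℕ → ℕ → ℕ → ℕ × ℕ → ℤ → ℕ) (G : Finset ℕ) {L : ℕ} (hL : 1 ≤ L) (hLN : L ≤ N)
    (hG : ∀ q ∈ G, q.Prime ∧ N < q ∧ q ≤ 2 * N) (b : ℕ) (Δ' ε₀ : ℝ) (k : ℕ) (w : ℕ × ℕ) {J : ℕ} (hJ : 1 ≤ J)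
    {τ₁ τ₂ : ℝ} (hτ₁ : τ₁ ∈ Set.Icc (1 / 2 : ℝ) 2) (hτ₂ : τ₂ ∈ Set.Icc (1 / 2 : ℝ) 2)
    (hDH : ∀ r l m d₁ d₂ i h₁ s, D r l m d₁ d₂ i h₁ s ≠ 0 → |h₁| ≤ (H_D : ℤ))
    (hDρ : ∀ x ∈ memberSet G (2 * N) N (coreHeight ε₀) T Δ', D x.r x.l x.m x.d₁ x.d₂ x.i x.h₁ x.s ≠ 0 →
      (((N + b * L : ℕ) : ℝ))⁻¹ - (((N + b * L + (L - 1) + 1 : ℕ) : ℝ))⁻¹ ≤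
        (((N + b * L + (L - 1) + 1 : ℕ) : ℝ))⁻¹ / (1 + 2 * (4 * π * Real.sqrt (((x.l / x.d₁ : ℕ) : ℝ) * (x.m / x.d₂ : ℕ) *
            (2 * 2 ^ x.i.1) * (2 * 2 ^ x.i.2)) / ((x.r + 1 : ℕ) : ℝ)) * (((N + b * L + (L - 1) + 1 : ℕ) : ℝ))⁻¹ +
          4 * π * (2 * 2 ^ x.i.1 * |(x.h₁ : ℝ) / (x.r + 1)| +
            2 * 2 ^ x.i.2 * |((((x.l / x.d₁ : ℕ) : ℤ) * (x.m / x.d₂ : ℕ) : ℝ)) / ((x.h₁ : ℝ) * (x.r + 1))|) *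
            (((N + b * L + (L - 1) + 1 : ℕ) : ℝ))⁻¹) / 2) :
    ‖∑ x ∈ memberSet G (2 * N) N (coreHeight ε₀) T Δ',
        ((if Nat.Coprime (x.l / x.d₁) (x.r + 1) then (1 : ℂ) else 0) *
          ((if IsUnit ((x.h₁ : ℤ) : ZMod (x.r + 1)) ∧ x.h₁ ≠ 0 then (1 : ℂ) else 0) *
            (if ((switchGcd (x.r + 1) x.s x.h₁ : ℤ) ∣ ((x.l / x.d₁ : ℕ) : ℤ) * (x.m / x.d₂ : ℕ) ∧
                IsUnit (switchClass (x.r + 1) (((x.l / x.d₁ : ℕ) : ℤ) * (x.m / x.d₂ : ℕ)) x.s x.h₁)) then (1 : ℂ) else 0) *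
            D x.r x.l x.m x.d₁ x.d₂ x.i x.h₁ x.s) *
          convexCoeff (fun q ↦ (coreRange Δ' ε₀ x.r x.l x.m x.d₁ x.d₂ x.i x.h₁ q ∧
              ¬ ((T x.r x.l x.m x.d₁ x.d₂ x.i x.h₁ : ℝ) <
                |(x.s : ℝ) + ((((x.l / x.d₁ : ℕ) : ℤ) * (x.m / x.d₂ : ℕ) : ℤ) : ℝ) / ((q * (x.r + 1) : ℕ) : ℝ)|)) ∧
              (N + b * L ≤ q ∧ q ≤ N + b * L + (L - 1))) (2 * N + 1) k *
          ((trinomCoeff x.l w.1 * trinomCoeff x.m w.2 : ℝ) : ℂ) *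
          (((2 : ℝ) ^ x.i.1 * 2 ^ x.i.2 : ℝ) : ℂ)) *
        ((((dyadicBump τ₁ * dyadicBump τ₂ *
            (((x.d₁ : ℝ) * (2 ^ x.i.1 * τ₁) * ((x.d₂ : ℝ) * (2 ^ x.i.2 * τ₂))) ^ (-(1 / 2 : ℝ)) *
              (((x.r + 1 : ℕ) : ℝ))⁻¹) : ℝ) : ℂ) * ker (2 ^ x.i.2 * τ₂) ((x.s : ℝ) / x.h₁)) *
          levelLargePart R (G.filter (fun q ↦ (q - N) / L = b))
            (fun q ↦ (e ((k : ℝ) * q / (2 * N + 1 : ℕ)) * (2 * (qhat q : ℂ) * (2 * π / q)) *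
                (((Real.log (qhat q ^ Δ'))⁻¹ ^ (w.1 + w.2) : ℝ) : ℂ)) *
              (((cutoffW ((4 * π ^ 2 * ((x.d₁ : ℝ) * (2 ^ x.i.1 * τ₁) * ((x.d₂ : ℝ) * (2 ^ x.i.2 * τ₂)))) *
                  ((q : ℝ))⁻¹) : ℝ) : ℂ) *
                ((besselJ 1 ((4 * π * Real.sqrt (((x.l / x.d₁ : ℕ) : ℝ) * (2 ^ x.i.1 * τ₁) *
                    (((x.m / x.d₂ : ℕ) : ℝ) * (2 ^ x.i.2 * τ₂))) / ((x.r + 1 : ℕ) : ℝ)) * ((q : ℝ))⁻¹) : ℝ) : ℂ) *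
                  Complex.exp (((-2 * π * ((2 ^ x.i.1 * τ₁) * ((x.h₁ : ℝ) / (x.r + 1)) +
                      (2 ^ x.i.2 * τ₂) * ((((x.l / x.d₁ : ℕ) : ℤ) * (x.m / x.d₂ : ℕ) : ℝ) / ((x.h₁ : ℝ) * (x.r + 1)))) *
                    ((q : ℝ))⁻¹ : ℝ) : ℂ) * I)))
            (switchMod (x.r + 1) x.s x.h₁)
            (switchClass (x.r + 1) (((x.l / x.d₁ : ℕ) : ℤ) * (x.m / x.d₂ : ℕ)) x.s x.h₁))‖ ≤
      (∑ j ∈ Finset.range J, (1 / 2 : ℝ) ^ j *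
          Real.sqrt (∑ q ∈ G.filter (fun q ↦ (q - N) / L = b),
            ‖(e ((k : ℝ) * q / (2 * N + 1 : ℕ)) * (2 * (qhat q : ℂ) * (2 * π / q)) *
                (((Real.log (qhat q ^ Δ'))⁻¹ ^ (w.1 + w.2) : ℝ) : ℂ)) *
              ((((((q : ℝ))⁻¹ - (((N + b * L + (L - 1) + 1 : ℕ) : ℝ))⁻¹) /
                ((((N + b * L : ℕ) : ℝ))⁻¹ - (((N + b * L + (L - 1) + 1 : ℕ) : ℝ))⁻¹)) ^ j : ℝ) : ℂ)‖ ^ 2)) *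
        (Real.sqrt (∑ h ∈ Finset.Icc 1 H_D, ∑ c' ∈ (Finset.range h).filter (fun c' ↦ c'.Coprime h),
            (∑ x ∈ ((memberSet G (2 * N) N (coreHeight ε₀) T Δ').filter (fun x ↦ x.h₁ ≠ 0 ∧
                (((switchGcd (x.r + 1) x.s x.h₁ : ℤ) ∣ ((x.l / x.d₁ : ℕ) : ℤ) * (x.m / x.d₂ : ℕ) ∧
                  IsUnit (switchClass (x.r + 1) (((x.l / x.d₁ : ℕ) : ℤ) * (x.m / x.d₂ : ℕ)) x.s x.h₁))) ∧
                D x.r x.l x.m x.d₁ x.d₂ x.i x.h₁ x.s ≠ 0)).filter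
                (fun x ↦ switchMod (x.r + 1) x.s x.h₁ = h ∧
                  (switchClass (x.r + 1) (((x.l / x.d₁ : ℕ) : ℤ) * (x.m / x.d₂ : ℕ)) x.s x.h₁).val = c'),
              ‖((if Nat.Coprime (x.l / x.d₁) (x.r + 1) then (1 : ℂ) else 0) *
                  ((if IsUnit ((x.h₁ : ℤ) : ZMod (x.r + 1)) ∧ x.h₁ ≠ 0 then (1 : ℂ) else 0) *
                    (if ((switchGcd (x.r + 1) x.s x.h₁ : ℤ) ∣ ((x.l / x.d₁ : ℕ) : ℤ) * (x.m / x.d₂ : ℕ) ∧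
                        IsUnit (switchClass (x.r + 1) (((x.l / x.d₁ : ℕ) : ℤ) * (x.m / x.d₂ : ℕ)) x.s x.h₁)) then (1 : ℂ) else 0) *
                    D x.r x.l x.m x.d₁ x.d₂ x.i x.h₁ x.s) *
                  convexCoeff (fun q ↦ (coreRange Δ' ε₀ x.r x.l x.m x.d₁ x.d₂ x.i x.h₁ q ∧
                      ¬ ((T x.r x.l x.m x.d₁ x.d₂ x.i x.h₁ : ℝ) <
                        |(x.s : ℝ) + ((((x.l / x.d₁ : ℕ) : ℤ) * (x.m / x.d₂ : ℕ) : ℤ) : ℝ) / ((q * (x.r + 1) : ℕ) : ℝ)|)) ∧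
                      (N + b * L ≤ q ∧ q ≤ N + b * L + (L - 1))) (2 * N + 1) k *
                  ((trinomCoeff x.l w.1 * trinomCoeff x.m w.2 : ℝ) : ℂ) *
                  (((2 : ℝ) ^ x.i.1 * 2 ^ x.i.2 : ℝ) : ℂ)) *
                (((dyadicBump τ₁ * dyadicBump τ₂ *
                    (((x.d₁ : ℝ) * (2 ^ x.i.1 * τ₁) * ((x.d₂ : ℝ) * (2 ^ x.i.2 * τ₂))) ^ (-(1 / 2 : ℝ)) *
                      (((x.r + 1 : ℕ) : ℝ))⁻¹) : ℝ) : ℂ) * ker (2 ^ x.i.2 * τ₂) ((x.s : ℝ) / x.h₁))‖) ^ 2) *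
          ((1 + Real.log H_D) * Real.sqrt (2 * ((N : ℝ) + 1) / R + 4 * H_D))) +
        J * (1 / 2) ^ J * (∑ x ∈ (memberSet G (2 * N) N (coreHeight ε₀) T Δ').filter (fun x ↦ x.h₁ ≠ 0 ∧
                (((switchGcd (x.r + 1) x.s x.h₁ : ℤ) ∣ ((x.l / x.d₁ : ℕ) : ℤ) * (x.m / x.d₂ : ℕ) ∧
                  IsUnit (switchClass (x.r + 1) (((x.l / x.d₁ : ℕ) : ℤ) * (x.m / x.d₂ : ℕ)) x.s x.h₁))) ∧
                D x.r x.l x.m x.d₁ x.d₂ x.i x.h₁ x.s ≠ 0),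
              ‖((if Nat.Coprime (x.l / x.d₁) (x.r + 1) then (1 : ℂ) else 0) *
                  ((if IsUnit ((x.h₁ : ℤ) : ZMod (x.r + 1)) ∧ x.h₁ ≠ 0 then (1 : ℂ) else 0) *
                    (if ((switchGcd (x.r + 1) x.s x.h₁ : ℤ) ∣ ((x.l / x.d₁ : ℕ) : ℤ) * (x.m / x.d₂ : ℕ) ∧
                        IsUnit (switchClass (x.r + 1) (((x.l / x.d₁ : ℕ) : ℤ) * (x.m / x.d₂ : ℕ)) x.s x.h₁)) then (1 : ℂ) else 0) *
                    D x.r x.l x.m x.d₁ x.d₂ x.i x.h₁ x.s) *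
                  convexCoeff (fun q ↦ (coreRange Δ' ε₀ x.r x.l x.m x.d₁ x.d₂ x.i x.h₁ q ∧
                      ¬ ((T x.r x.l x.m x.d₁ x.d₂ x.i x.h₁ : ℝ) <
                        |(x.s : ℝ) + ((((x.l / x.d₁ : ℕ) : ℤ) * (x.m / x.d₂ : ℕ) : ℤ) : ℝ) / ((q * (x.r + 1) : ℕ) : ℝ)|)) ∧
                      (N + b * L ≤ q ∧ q ≤ N + b * L + (L - 1))) (2 * N + 1) k *
                  ((trinomCoeff x.l w.1 * trinomCoeff x.m w.2 : ℝ) : ℂ) *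
                  (((2 : ℝ) ^ x.i.1 * 2 ^ x.i.2 : ℝ) : ℂ)) *
                (((dyadicBump τ₁ * dyadicBump τ₂ *
                    (((x.d₁ : ℝ) * (2 ^ x.i.1 * τ₁) * ((x.d₂ : ℝ) * (2 ^ x.i.2 * τ₂))) ^ (-(1 / 2 : ℝ)) *
                      (((x.r + 1 : ℕ) : ℝ))⁻¹) : ℝ) : ℂ) * ker (2 ^ x.i.2 * τ₂) ((x.s : ℝ) / x.h₁))‖) *
          ∑ q ∈ G.filter (fun q ↦ (q - N) / L = b),
            ‖e ((k : ℝ) * q / (2 * N + 1 : ℕ)) * (2 * (qhat q : ℂ) * (2 * π / q)) *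
                (((Real.log (qhat q ^ Δ'))⁻¹ ^ (w.1 + w.2) : ℝ) : ℂ)‖ := by
  set M := memberSet G (2 * N) N (coreHeight ε₀) T Δ' with hM
  set good : MemberIdx → Prop := fun x ↦ x.h₁ ≠ 0 ∧
      (((switchGcd (x.r + 1) x.s x.h₁ : ℤ) ∣ ((x.l / x.d₁ : ℕ) : ℤ) * (x.m / x.d₂ : ℕ) ∧
        IsUnit (switchClass (x.r + 1) (((x.l / x.d₁ : ℕ) : ℤ) * (x.m / x.d₂ : ℕ)) x.s x.h₁))) ∧
      D x.r x.l x.m x.d₁ x.d₂ x.i x.h₁ x.s ≠ 0 with hgood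
  -- Step 1: restrict to good members and regroup `c·(Kern·LLP) = (c·Kern)·LLP`
  have hrestrict : ∀ x ∈ M, x ∉ M.filter good →
      ((if Nat.Coprime (x.l / x.d₁) (x.r + 1) then (1 : ℂ) else 0) *
          ((if IsUnit ((x.h₁ : ℤ) : ZMod (x.r + 1)) ∧ x.h₁ ≠ 0 then (1 : ℂ) else 0) *
            (if ((switchGcd (x.r + 1) x.s x.h₁ : ℤ) ∣ ((x.l / x.d₁ : ℕ) : ℤ) * (x.m / x.d₂ : ℕ) ∧
                IsUnit (switchClass (x.r + 1) (((x.l / x.d₁ : ℕ) : ℤ) * (x.m / x.d₂ : ℕ)) x.s x.h₁)) then (1 : ℂ) else 0) *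
            D x.r x.l x.m x.d₁ x.d₂ x.i x.h₁ x.s) *
          convexCoeff (fun q ↦ (coreRange Δ' ε₀ x.r x.l x.m x.d₁ x.d₂ x.i x.h₁ q ∧
              ¬ ((T x.r x.l x.m x.d₁ x.d₂ x.i x.h₁ : ℝ) <
                |(x.s : ℝ) + ((((x.l / x.d₁ : ℕ) : ℤ) * (x.m / x.d₂ : ℕ) : ℤ) : ℝ) / ((q * (x.r + 1) : ℕ) : ℝ)|)) ∧
              (N + b * L ≤ q ∧ q ≤ N + b * L + (L - 1))) (2 * N + 1) k *
          ((trinomCoeff x.l w.1 * trinomCoeff x.m w.2 : ℝ) : ℂ) *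
          (((2 : ℝ) ^ x.i.1 * 2 ^ x.i.2 : ℝ) : ℂ)) = 0 := by
    intro x hx hng
    have hng' : ¬ good x := fun h ↦ hng (Finset.mem_filter.mpr ⟨hx, h⟩)
    by_cases h0 : x.h₁ = 0
    · have : ¬ (IsUnit ((x.h₁ : ℤ) : ZMod (x.r + 1)) ∧ x.h₁ ≠ 0) := fun h ↦ h.2 h0
      rw [if_neg this]; simp
    by_cases hadm : ((switchGcd (x.r + 1) x.s x.h₁ : ℤ) ∣ ((x.l / x.d₁ : ℕ) : ℤ) * (x.m / x.d₂ : ℕ) ∧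
        IsUnit (switchClass (x.r + 1) (((x.l / x.d₁ : ℕ) : ℤ) * (x.m / x.d₂ : ℕ)) x.s x.h₁))
    swap
    · rw [if_neg hadm]; simp
    have hD0 : D x.r x.l x.m x.d₁ x.d₂ x.i x.h₁ x.s = 0 := by
      by_contra hD
      exact hng' ⟨h0, hadm, hD⟩
    rw [hD0]; simp
  rw [← Finset.sum_subset (Finset.filter_subset good M) (fun x hx hng ↦ by rw [hrestrict x hx hng, zero_mul])]
  simp only [← mul_assoc (_ : ℂ) (_ : ℂ) (levelLargePart _ _ _ _ _)]
  -- Step 2: the data of the aggregate large sieve (F2b)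
  have hβ₁ : (0 : ℝ) < ((N + b * L : ℕ) : ℝ) := by
    have : 0 < N + b * L := by omega
    exact_mod_cast this
  have hβ₂ : (0 : ℝ) < ((N + b * L + (L - 1) + 1 : ℕ) : ℝ) := by positivity
  have hlt : ((N + b * L : ℕ) : ℝ) < ((N + b * L + (L - 1) + 1 : ℕ) : ℝ) := by exact_mod_cast (by omega)
  have hle2 : ((N + b * L + (L - 1) + 1 : ℕ) : ℝ) ≤ 2 * ((N + b * L : ℕ) : ℝ) := by
    have : N + b * L + (L - 1) + 1 ≤ 2 * (N + b * L) := by omega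
    exact_mod_cast this
  have hℓ : (0 : ℝ) < (((N + b * L : ℕ) : ℝ))⁻¹ - (((N + b * L + (L - 1) + 1 : ℕ) : ℝ))⁻¹ := by
    rw [sub_pos]
    exact (inv_lt_inv₀ hβ₂ hβ₁).mpr hlt
  have ht₁ : (((N + b * L + (L - 1) + 1 : ℕ) : ℝ))⁻¹ +
      ((((N + b * L : ℕ) : ℝ))⁻¹ - (((N + b * L + (L - 1) + 1 : ℕ) : ℝ))⁻¹) ≤
      2 * (((N + b * L + (L - 1) + 1 : ℕ) : ℝ))⁻¹ := by
    rw [add_sub_cancel, ← div_eq_mul_inv, le_div_iff₀ hβ₂, inv_mul_le_iff₀ hβ₁]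
    linarith
  have hQ : G.filter (fun q ↦ (q - N) / L = b) ⊆ (Finset.Ioc N (2 * N)).filter Nat.Prime := by
    intro q hq
    obtain ⟨hqG, -⟩ := Finset.mem_filter.mp hq
    obtain ⟨hp, h1, h2⟩ := hG q hqG
    exact Finset.mem_filter.mpr ⟨Finset.mem_Ioc.mpr ⟨h1, h2⟩, hp⟩
  have hQt : ∀ q ∈ G.filter (fun q ↦ (q - N) / L = b), ((q : ℝ))⁻¹ ∈
      Set.Icc ((((N + b * L + (L - 1) + 1 : ℕ) : ℝ))⁻¹)
        ((((N + b * L + (L - 1) + 1 : ℕ) : ℝ))⁻¹ + ((((N + b * L : ℕ) : ℝ))⁻¹ - (((N + b * L + (L - 1) + 1 : ℕ) : ℝ))⁻¹)) := by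
    intro q hq
    obtain ⟨hqG, hkey⟩ := Finset.mem_filter.mp hq
    obtain ⟨hb1, hb2⟩ := (blockKey_eq_iff hL (hG q hqG).2.1.le).mp hkey
    have hq0 : (0 : ℝ) < q := by exact_mod_cast (hG q hqG).1.pos
    rw [add_sub_cancel]
    constructor
    · exact (inv_le_inv₀ hβ₂ hq0).mpr (by exact_mod_cast (by omega : q ≤ N + b * L + (L - 1) + 1))
    · exact (inv_le_inv₀ hq0 hβ₁).mpr (by exact_mod_cast hb1)
  have hfam : ∀ x ∈ M.filter good, x ∈ M ∧ good x := fun x hx ↦ Finset.mem_filter.mp hx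
  have hI : ∀ x ∈ M.filter good, switchMod (x.r + 1) x.s x.h₁ ∈ Finset.Icc 1 H_D ∧
      IsUnit (switchClass (x.r + 1) (((x.l / x.d₁ : ℕ) : ℤ) * (x.m / x.d₂ : ℕ)) x.s x.h₁) := by
    intro x hx
    obtain ⟨-, h0, hadm, hD⟩ := hfam x hx
    refine ⟨Finset.mem_Icc.mpr ⟨Nat.one_le_iff_ne_zero.mpr (switchMod_ne_zero _ _ h0), ?_⟩, hadm.2⟩
    have h1 : (switchMod (x.r + 1) x.s x.h₁ : ℤ) ≤ |x.h₁| :=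
      Int.le_of_dvd (abs_pos.mpr h0) ((dvd_abs _ _).mpr (natCast_switchMod_dvd _ x.s x.h₁))
    have h2 := hDH _ _ _ _ _ _ _ _ hD
    exact_mod_cast h1.trans h2
  exact norm_sum_family_levelFactor_le (M.filter good) (fun x ↦ x.d₁) (fun x ↦ x.d₂) (fun x ↦ x.l / x.d₁)
    (fun x ↦ x.m / x.d₂) (fun x ↦ x.r + 1) (fun x ↦ (2 : ℝ) ^ x.i.1) (fun x ↦ (2 : ℝ) ^ x.i.2)
    (fun x ↦ (x.h₁ : ℝ) / (x.r + 1)) (fun x ↦ ((((x.l / x.d₁ : ℕ) : ℤ) * (x.m / x.d₂ : ℕ) : ℝ)) / ((x.h₁ : ℝ) * (x.r + 1)))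
    (fun x hx ↦ Nat.pos_of_mem_divisors (mem_memberSet (hfam x hx).1).2.2.2.1)
    (fun x hx ↦ Nat.pos_of_mem_divisors (mem_memberSet (hfam x hx).1).2.2.2.2.1)
    (fun x _ ↦ by positivity) (fun x _ ↦ by positivity) (inv_pos.mpr hβ₂) hℓ (le_refl _) ht₁
    (fun x hx ↦ hDρ x (hfam x hx).1 (hfam x hx).2.2.2) hJ hτ₁ hτ₂ hR _ hQ hH hQt _
    (fun x ↦ switchMod (x.r + 1) x.s x.h₁)
    (fun x ↦ switchClass (x.r + 1) (((x.l / x.d₁ : ℕ) : ℤ) * (x.m / x.d₂ : ℕ)) x.s x.h₁) hI _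

end Summit.Parity.GeneralizedHardyLittlewood.Theorems.BeyondDiagonalBeatsQuarter.OffDiag
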